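import Literature.IUT.HodgeTheaters.SplitFrobenioids
import HarnessLib

/-!
# [IUTchI] Example 3.2: Frobenioids at bad nonarchimedean primes (INTERFACE)

S. Mochizuki, *Inter-universal Teichmüller theory I*, §3, Example 3.2 "Frobenioids at Bad
Nonarchimedean Primes" (i)–(vi), kurims final manuscript May 2020 pp. 69–73, and Remarks 3.2.2,
3.2.3 (pp. 74–75) [claim: Mochizuki2012, status: disputed]. DEFINITIONS only; nothing asserted.

The Example CONSTRUCTS, for `v ∈ V̲^bad`, out of inputs ABSENT from the tree — the tempered
Frobenioid of [EtTh] §5 with its Frobenioid-theoretic theta function, the `p_v`-adic Frobenioids of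
[FrdII] Ex. 1.1, the temperoid `B^temp(X̲̲_v)⁰`, birationalisation [FrdI] §4 — the data
`D_v ⊇ D⊢_v`, `F̲_v`, `T_(−)`, `F÷_v`, `Ÿ_v`, `Θ̲_v` (up to `μ_{2l}` and `l·ℤ`), `C_v`, `q_v`,
`q̲_v = q_v^{1/2l}`, `C⊢_v`, `τ⊢_v`, `D^Θ_v`, `𝒪^▷_{C^Θ_v}`, `C^Θ_v`, `τ^Θ_v`, `F⊢_v ⥲ F^Θ_v`. It is
typed as ONE INTERFACE structure `BadLocalFrobenioid l K_v` over the completed field `K_v` (a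
valued field; `𝒪^▷_{K_v}` is the REAL `PadicFrd.intNonzero`), one field (group) per printed object,
sub-item locator in every field docstring; what Mathlib can state IS stated (full faithful
`D⊢_v ⊆ D_v` with its left adjoint, `D^Θ_v ⊆ (D_v)_{Ÿ_v}` full, the faithful inclusions
`C_v ⊆ F̲_v`, `C⊢_v ⊆ C_v`, `C^Θ_v ⊆ F÷_v` lying over the base inclusions, the equivalences
`D⊢_v ⥲ D^Θ_v`, `C⊢_v ⥲ C^Θ_v` with transport of splittings, `q̲_v^{2l} = q_v` in `𝒪^▷_{K_v}`; the
indeterminacy orbit of `Θ̲_v` is DEFINED as the least `μ_{2l}`- and `l·ℤ`-stable set containing it,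
`thetaOrbit`; `τ⊢_v`, `τ^Θ_v` are carried as the ORBITS `tauDashOrbit` (splittings of all `2l`-th
roots of `q_v`) / `tauThetaOrbit` (of the `μ_{2l}`-multiples of `Θ̲_v`) with recorded members
`tauDash`, `tauTheta`, and (vi) (e)/(f) preserve orbits, not members); the reconstruction sentences (ii) (`F÷_v`;
`T_{Ÿ_v}`, `Θ̲_v`), (iii) (`C_v`), (vi) (a)–(f) and Rmk 3.2.3 (i) are `Prop`s in the reading of
Rmk 3.2.1 (i) (`ReconstructibleAlong`, from `SplitFrobenioids.lean`).

Deliberately NOT here: a `Realization` bridge to `HodgeTheaterModel.Loc v` of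
`ThetaHodgeTheaters.lean` (when [IUTchII] consumers ask); the Frobenioid-level form of Rmk 3.2.3 (i)
(typed at the level of the monoids `𝒪^▷_{C^{Θ′}_v}`, `OrbitActsOnFtheta`); "the value of `Θ̲_v` at
`√−q_v` is `q̲_v`" (Ex. 3.2 (iv); evaluation at points is [EtTh] Prop. 1.4 material) beyond
`q̲_v^{2l} = q_v`; Ex. 3.2 (v)'s natural isomorphisms `𝒪^▷_{C⊢_v}(−) ⥲ 𝒪^▷_{C^Θ_v}(−)`,
`𝒪^×_{C⊢_v}(−) ⥲ 𝒪^×_{C^Θ_v}(−)` "compatible with `q̲_v|_{T_A} ↦ Θ̲_v|_{T_{A^Θ}}`" (p. 72; they need the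
monoids of [FrdI] Prop. 2.2, of which only `𝒪^▷_{C^Θ_v}` is carried here); Rmk 3.2.2 ("`N·Φ_{C⊢_v}` is absolutely
primitive" — needs [FrdII] Ex. 1.1 (ii)); Rmk 3.2.3 (ii) (pull-backs along linear morphisms);
Rmk 3.2.1 (terminology), Rmk 3.2.4 (errata to [EtTh] §3–4).
-/

namespace Literature.IUT.HodgeTheaters

open CategoryTheory Literature.AlgebraicGeometry.Frobenioids

universe u

/-! ### Example 3.2: `v ∈ V̲^bad` -/
/-- The least subset of a group `G` containing `θ` and stable under left multiplication by the
`2l`-torsion of a subgroup `U` and under a family `C` of self-maps (used for "`Θ̲_v` regarded up to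
`μ_{2l}` and the action of `l·ℤ`", Ex. 3.2 (ii)). [claim: Mochizuki2012, status: disputed] -/
def orbitClosure {G : Type u} [Group G] (θ : G) (U : Subgroup G) (l : ℕ) (C : Set (G → G)) :
    Set G :=
  ⋂₀ {S : Set G | θ ∈ S ∧ (∀ ζ ∈ U, ζ ^ (2 * l) = 1 → ∀ x ∈ S, ζ * x ∈ S) ∧
    ∀ c ∈ C, ∀ x ∈ S, c x ∈ S}
/-- `θ` lies in its orbit closure — PROVED. [claim: Mochizuki2012, status: disputed] -/
theorem mem_orbitClosure_self {G : Type u} [Group G] (θ : G) (U : Subgroup G) (l : ℕ)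
    (C : Set (G → G)) : θ ∈ orbitClosure θ U l C :=
  Set.mem_sInter.2 fun _ hS => hS.1
/-- The orbit closure is stable under the `2l`-torsion of `U` — PROVED. [claim: Mochizuki2012, status: disputed] -/
theorem mul_mem_orbitClosure {G : Type u} [Group G] {θ : G} {U : Subgroup G} {l : ℕ}
    {C : Set (G → G)} {ζ x : G} (hζ : ζ ∈ U) (hl : ζ ^ (2 * l) = 1)
    (hx : x ∈ orbitClosure θ U l C) : ζ * x ∈ orbitClosure θ U l C :=
  Set.mem_sInter.2 fun S hS => hS.2.1 ζ hζ hl x (Set.mem_sInter.1 hx S hS)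
/-- The orbit closure is stable under the maps of `C` — PROVED. [claim: Mochizuki2012, status: disputed] -/
theorem map_mem_orbitClosure {G : Type u} [Group G] {θ : G} {U : Subgroup G} {l : ℕ}
    {C : Set (G → G)} {c : G → G} {x : G} (hc : c ∈ C) (hx : x ∈ orbitClosure θ U l C) :
    c x ∈ orbitClosure θ U l C :=
  Set.mem_sInter.2 fun S hS => hS.2.2 c hc x (Set.mem_sInter.1 hx S hS)
/-- Minimality of the orbit closure — PROVED. [claim: Mochizuki2012, status: disputed] -/
theorem orbitClosure_subset {G : Type u} [Group G] {θ : G} {U : Subgroup G} {l : ℕ}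
    {C : Set (G → G)} {S : Set G} (h0 : θ ∈ S)
    (h1 : ∀ ζ ∈ U, ζ ^ (2 * l) = 1 → ∀ x ∈ S, ζ * x ∈ S) (h2 : ∀ c ∈ C, ∀ x ∈ S, c x ∈ S) :
    orbitClosure θ U l C ⊆ S :=
  Set.sInter_subset_of_mem ⟨h0, h1, h2⟩
/-- **[IUTchI] Example 3.2** (Frobenioids at bad nonarchimedean primes), pp. 69–73, for a place
`v ∈ V̲^bad` with completed base field `K_v` (a valued field) and the prime `l` of the initial
Θ-data: the data (i)–(v) as an INTERFACE, one field (group) per printed object.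
[claim: Mochizuki2012, status: disputed] -/
structure BadLocalFrobenioid (l : ℕ) (Kv : Type) [Field Kv] [ValuativeRel Kv] where
  /-- (i) `D_v`, "the category of connected tempered coverings `B^temp(X̲̲_v)⁰`" of the model `X̲̲_v`
  (TODO-merge:abc-iut-L3-t2, abc-iut-L5-t1 `BTemp`) -/
  Dv : Type u
  /-- category structure on `D_v` -/
  [instDv : Category.{u} Dv]
  /-- (i) `D⊢_v := B(K_v)⁰` -/
  Ddash : Type u
  /-- category structure on `D⊢_v` -/
  [instDdash : Category.{u} Ddash]
  /-- (i) "`D⊢_v` may be naturally regarded [by pulling back finite étale coverings via the structure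
  morphism `X̲̲_v → Spec(K_v)`] as a full subcategory `D⊢_v ⊆ D_v`": the inclusion … -/
  incl : Ddash ⥤ Dv
  /-- … is full … -/
  [incl_full : incl.Full]
  /-- … and faithful -/
  [incl_faithful : incl.Faithful]
  /-- (i) "a natural functor `D_v → D⊢_v`, which is left-adjoint to the natural inclusion functor"
  ([FrdII] Ex. 1.3 (ii)) -/
  proj : Dv ⥤ Ddash
  /-- the adjunction `proj ⊣ incl` -/
  adj : proj ⊣ incl
  /-- (i) `F̲_v`, the tempered Frobenioid of [EtTh] §5 ("the Frobenioid denoted `C`") as a category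
  (TODO-merge:abc-iut-L2-t3/t4) … -/
  Fv : Type u
  /-- category structure on `F̲_v` -/
  [instFv : Category.{u} Fv]
  /-- … over the base category `D_v` -/
  toBase : Fv ⥤ Dv
  /-- (i) "`T_(−)`, the Frobenius-trivial object [a notion which is category-theoretic] of `F̲_v`
  [completely determined up to isomorphism] that lies over `(−)`" -/
  T : Dv → Fv
  /-- `T_A` lies over `A` -/
  T_base : ∀ A : Dv, toBase.obj (T A) ≅ A
  /-- (ii) `F÷_v := F̲_v^birat`, the birationalization ([FrdI] §4) … -/
  Fbirat : Type u
  /-- category structure on `F÷_v` -/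
  [instFbirat : Category.{u} Fbirat]
  /-- … with the functor `F̲_v → F÷_v`, "the image in `F÷_v` of an object of `F̲_v`" … -/
  birat : Fv ⥤ Fbirat
  /-- … over the same base category `D_v` (birationalization keeps the base, [FrdI] §4) … -/
  biratBase : Fbirat ⥤ Dv
  /-- … compatibly -/
  birat_base : Nonempty (birat ⋙ biratBase ≅ toBase)
  /-- (ii) `Ÿ_v → X̲̲_v`, "the tempered covering determined by the object `Ÿ^log` … we may think of
  `Ÿ_v` as an object of `D_v`" -/
  Ydd : Dv
  /-- (ii) `𝒪^×(T^÷_{Ÿ_v})`, the group of units of the birational image of `T_{Ÿ_v}`, as a subgroup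
  of its automorphisms … -/
  unitsTY : Subgroup (Aut (birat.obj (T Ydd)))
  /-- … which is commutative -/
  unitsTY_comm : ∀ x ∈ unitsTY, ∀ y ∈ unitsTY, x * y = y * x
  /-- (ii) `Θ̲_v ∈ 𝒪^×(T^÷_{Ÿ_v})`, "the reciprocal of [the Frobenioid-theoretic] `l`-th root of the
  theta function, normalized so as to attain the value `1` at the point `√−1`" ([EtTh] Thm. 5.7) -/
  theta : Aut (birat.obj (T Ydd))
  /-- `Θ̲_v` is a unit -/
  theta_mem : theta ∈ unitsTY
  /-- (ii) "the group of automorphisms `l·ℤ ⊆ Aut(T_{Ÿ_v})`" ([EtTh] Thm. 5.7 "`ℤ`"); "`Θ̲_v` is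
  completely determined up to multiplication by a `2l`-th root of unity [i.e., an element of
  `μ_{2l}(T^÷_{Ÿ_v})`] and the action of" this group — the indeterminacy orbit is DEFINED below
  (`thetaOrbit`, the least set containing `Θ̲_v` stable under both) -/
  lZ : Subgroup (Aut (T Ydd))
  /-- (iii) `C_v ⊆ F̲_v`, "the `p_v`-adic Frobenioid constituted by the base-field-theoretic hull"
  ([EtTh] Cor. 3.8 (ii), Def. 3.6 (iv) "`C^bs-fld`"; TODO-merge:abc-iut-L1-t4 [FrdII] Ex. 1.1) … -/
  Cv : Type u
  /-- category structure on `C_v` -/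
  [instCv : Category.{u} Cv]
  /-- … as a subcategory of `F̲_v` -/
  hull : Cv ⥤ Fv
  /-- the hull functor is faithful -/
  [hull_faithful : hull.Faithful]
  /-- (iv) `q_v ∈ 𝒪^▷(T_{X̲̲_v}) (≅ 𝒪^▷_{K_v})`, "the `q`-parameter of the elliptic curve `E_v` over
  `K_v`" (REAL ambient monoid `𝒪^▷_{K_v}` = `PadicFrd.intNonzero`) -/
  q : PadicFrd.intNonzero Kv
  /-- (iv) `q̲_v := q_v^{1/2l} ∈ 𝒪^▷(T_{X̲̲_v})`: "it follows from our assumption concerning `2`-torsion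
  …, together with the definition of `K`, that `q_v` admits a `2l`-th root in `𝒪^▷(T_{X̲̲_v})`" —
  a chosen root, "completely determined up to a `μ_{2l}(T_{X̲̲_v})`-multiple" ("the value of `Θ̲_v`
  at `√−q_v`", [EtTh] Prop. 1.4 (ii), is not typed here) … -/
  qroot : PadicFrd.intNonzero Kv
  /-- … with `q̲_v^{2l} = q_v` -/
  qroot_pow : qroot ^ (2 * l) = q
  /-- (iv) `C⊢_v (⊆ C_v)`, "a `p_v`-adic Frobenioid with base category given by `D⊢_v`" determined by
  the submonoid `Φ_{C⊢_v} := ℕ·log_Φ(q̲_v)|_{D⊢_v} ⊆ Φ_{C_v}|_{D⊢_v}` ([FrdII] Ex. 1.1 (ii)) … -/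
  Cdash : Type u
  /-- category structure on `C⊢_v` -/
  [instCdash : Category.{u} Cdash]
  /-- … over `D⊢_v` … -/
  CdashBase : Cdash ⥤ Ddash
  /-- … "which may be thought of as a subcategory of `C_v`" (faithful inclusion; not asserted full:
  `Φ_{C⊢_v} = ℕ·log_Φ(q̲_v)|_{D⊢_v}` is a proper submonoid of `Φ_{C_v}|_{D⊢_v}`) … -/
  CdashToC : Cdash ⥤ Cv
  /-- … faithful … -/
  [CdashToC_faithful : CdashToC.Faithful]
  /-- … and lying over the inclusion of bases `D⊢_v ⊆ D_v` ("with base category given by `D⊢_v`"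
  inside `C_v ⊆ F̲_v` over `D_v`) -/
  CdashToC_base : Nonempty (CdashToC ⋙ hull ⋙ toBase ≅ CdashBase ⋙ incl)
  /-- (iv) the characteristic splitting on `C⊢_v` determined by a `2l`-th root `q′` of `q_v`
  (`ℕ·log_Φ(q′)`, [FrdI] Def. 2.3); `τ⊢_v` is "a `μ_{2l}(−)`-ORBIT of characteristic splittings"
  = these splittings for all `2l`-th roots of `q_v` (`tauDashOrbit` below; the member for `q̲_v` is
  `tauDash`) -/
  tauDashOf : PadicFrd.intNonzero Kv → S3Local.CharSplitting Cdash
  /-- (v) `D^Θ_v ⊆ (D_v)_{Ÿ_v}`, "the full subcategory … determined by the products in `D_v` of `Ÿ_v`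
  with objects of `D⊢_v`" … -/
  DTheta : Type u
  /-- category structure on `D^Θ_v` -/
  [instDTheta : Category.{u} DTheta]
  /-- … as a full subcategory of the slice `(D_v)_{Ÿ_v}` … -/
  DThetaIncl : DTheta ⥤ Over Ydd
  /-- … (full) … -/
  [DThetaIncl_full : DThetaIncl.Full]
  /-- … (faithful) -/
  [DThetaIncl_faithful : DThetaIncl.Faithful]
  /-- (v) "'forming the product with `Ÿ_v`' determines a natural equivalence of categories
  `D⊢_v ⥲ D^Θ_v`", `A ↦ A^Θ := Ÿ_v × A` -/
  prodEquiv : Ddash ≌ DTheta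
  /-- (v) the monoid `𝒪^▷_{C^Θ_v}(−)` on `D^Θ_v`, "`A^Θ ↦ 𝒪^×(T_{A^Θ})·(Θ̲_v^ℕ|_{T_{A^Θ}})`"
  ([FrdI] Def. 1.1 (ii): a contravariant functor to commutative monoids) … -/
  OTheta : DThetaᵒᵖ ⥤ CommMonCat.{u}
  /-- … with "the submonoid `𝒪^×_{C^Θ_v}(−) ⊆ 𝒪^▷_{C^Θ_v}(−)` determined by the invertible elements" -/
  OThetaUnits : ∀ A : DThetaᵒᵖ, Submonoid (OTheta.obj A)
  /-- the submonoid of units consists of units -/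
  OThetaUnits_isUnit : ∀ A x, x ∈ OThetaUnits A ↔ IsUnit x
  /-- (v) applied to any unit `Θ̲′ ∈ 𝒪^×(T^÷_{Ÿ_v})` in place of `Θ̲_v` (the members of the orbit are
  the `Θ̲^α_v` of Rmk 3.2.3 (i)): the monoid "`A^Θ ↦ 𝒪^×(T_{A^Θ})·(Θ̲′^ℕ|_{T_{A^Θ}})`" on `D^Θ_v` … -/
  OThetaOf : Aut (birat.obj (T Ydd)) → DThetaᵒᵖ ⥤ CommMonCat.{u}
  /-- … which for `Θ̲′ = Θ̲_v` is `𝒪^▷_{C^Θ_v}` -/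
  OThetaOf_theta : OThetaOf theta = OTheta
  /-- (v) `C^Θ_v (⊆ F÷_v)`, "a `p_v`-adic Frobenioid with base category given by `D^Θ_v`" determined by
  `𝒪^▷_{C^Θ_v}` ([FrdII] Ex. 1.1 (ii)) … -/
  CTheta : Type u
  /-- category structure on `C^Θ_v` -/
  [instCTheta : Category.{u} CTheta]
  /-- … over `D^Θ_v` … -/
  CThetaBase : CTheta ⥤ DTheta
  /-- … "which may be thought of as a subcategory of `F÷_v`" (faithful inclusion) … -/
  CThetaToBirat : CTheta ⥤ Fbirat
  /-- … faithful … -/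
  [CThetaToBirat_faithful : CThetaToBirat.Faithful]
  /-- … and lying over `D^Θ_v ⊆ (D_v)_{Ÿ_v} → D_v` ("with base category given by `D^Θ_v`") -/
  CThetaToBirat_base :
    Nonempty (CThetaToBirat ⋙ biratBase ≅ CThetaBase ⋙ DThetaIncl ⋙ Over.forget Ydd)
  /-- (v) the characteristic splitting on `C^Θ_v` determined by a unit `Θ̲′ ∈ 𝒪^×(T^÷_{Ÿ_v})` in place of
  `Θ̲_v` (`ℕ·log_Φ(Θ̲′)`); `τ^Θ_v` is "a `μ_{2l}(−)`-orbit of characteristic splittings … determined by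
  `Θ̲_v`" = these for the `μ_{2l}`-multiples of `Θ̲_v` (`tauThetaOrbit`; the member for `Θ̲_v` is
  `tauTheta`). MODELLING NOTE: the printed `C^{Θ̲′}_v ⊆ F÷_v` for the other members `Θ̲′` of the
  indeterminacy orbit are distinct but isomorphic subcategories (Rmk 3.2.3 (i)); here they are
  modelled on the single carrier `CTheta` with varying monoid `OThetaOf Θ̲′` and splitting
  `tauThetaOf Θ̲′` (declared) -/
  tauThetaOf : Aut (birat.obj (T Ydd)) → S3Local.CharSplitting CTheta
  /-- (v) "we have a natural equivalence of categories `C⊢_v ⥲ C^Θ_v` …" (compatible with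
  "`q̲_v|_{T_A} ↦ Θ̲_v|_{T_{A^Θ}}`") … -/
  dashThetaEquiv : Cdash ≌ CTheta
  /-- … "that maps `τ⊢_v` to `τ^Θ_v`" (the member for `q̲_v` to the member for `Θ̲_v`) -/
  dashThetaEquiv_tau : (tauDashOf qroot).IsPreservedBy (tauThetaOf theta) dashThetaEquiv.functor
  /-- the equivalence lies over `D⊢_v ⥲ D^Θ_v` -/
  dashThetaEquiv_base : Nonempty (CdashBase ⋙ prodEquiv.functor ≅ dashThetaEquiv.functor ⋙ CThetaBase)

attribute [instance] BadLocalFrobenioid.instDv BadLocalFrobenioid.instDdash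
  BadLocalFrobenioid.incl_full BadLocalFrobenioid.incl_faithful BadLocalFrobenioid.instFv
  BadLocalFrobenioid.instFbirat BadLocalFrobenioid.instCv BadLocalFrobenioid.hull_faithful
  BadLocalFrobenioid.instCdash BadLocalFrobenioid.CdashToC_faithful BadLocalFrobenioid.instDTheta
  BadLocalFrobenioid.DThetaIncl_full BadLocalFrobenioid.DThetaIncl_faithful
  BadLocalFrobenioid.instCTheta BadLocalFrobenioid.CThetaToBirat_faithful

namespace BadLocalFrobenioid

variable {l : ℕ} {Kv : Type} [Field Kv] [ValuativeRel Kv]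
/-- The member of `τ⊢_v` determined by the chosen root `q̲_v` (Ex. 3.2 (iv)).
[claim: Mochizuki2012, status: disputed] -/
def tauDash (B : BadLocalFrobenioid.{u} l Kv) : S3Local.CharSplitting B.Cdash := B.tauDashOf B.qroot
/-- `τ⊢_v`, "a `μ_{2l}(−)`-orbit of characteristic splittings on `C⊢_v`" (Ex. 3.2 (iv)): the splittings
determined by ALL the `2l`-th roots of `q_v` in `𝒪^▷_{K_v}` (= the `μ_{2l}`-multiples of `q̲_v`).
[claim: Mochizuki2012, status: disputed] -/
def tauDashOrbit (B : BadLocalFrobenioid.{u} l Kv) : Set (S3Local.CharSplitting B.Cdash) :=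
  {τ | ∃ q' : PadicFrd.intNonzero Kv, q' ^ (2 * l) = B.q ∧ τ = B.tauDashOf q'}
/-- `tauDash ∈ τ⊢_v` — PROVED. [claim: Mochizuki2012, status: disputed] -/
theorem tauDash_mem_tauDashOrbit (B : BadLocalFrobenioid.{u} l Kv) : B.tauDash ∈ B.tauDashOrbit :=
  ⟨B.qroot, B.qroot_pow, rfl⟩
/-- The member of `τ^Θ_v` determined by `Θ̲_v` (Ex. 3.2 (v)). [claim: Mochizuki2012, status: disputed] -/
def tauTheta (B : BadLocalFrobenioid.{u} l Kv) : S3Local.CharSplitting B.CTheta := B.tauThetaOf B.theta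
/-- `F⊢_v := (C⊢_v, τ⊢_v)` (Ex. 3.2 (v)), with the recorded member of the orbit `τ⊢_v`.
[claim: Mochizuki2012, status: disputed] -/
def Fdash (B : BadLocalFrobenioid.{u} l Kv) : SplitFrobenioid.{u} := ⟨B.Cdash, B.tauDash⟩
/-- `F^Θ_v := (C^Θ_v, τ^Θ_v)` (Ex. 3.2 (v)), with the recorded member of the orbit `τ^Θ_v`.
[claim: Mochizuki2012, status: disputed] -/
def Ftheta (B : BadLocalFrobenioid.{u} l Kv) : SplitFrobenioid.{u} := ⟨B.CTheta, B.tauTheta⟩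

/-- `μ_{2l}(T^÷_{Ÿ_v})`: the `2l`-th roots of unity among the units (Ex. 3.2 (ii)).
[claim: Mochizuki2012, status: disputed] -/
def mu2l (B : BadLocalFrobenioid.{u} l Kv) : Set (Aut (B.birat.obj (B.T B.Ydd))) := {ζ | ζ ∈ B.unitsTY ∧ ζ ^ (2 * l) = 1}

/-- The conjugation maps `x ↦ α⁻¹ x α` on `𝒪^×(T^÷_{Ÿ_v}) ⊆ Aut(T^÷_{Ÿ_v})` by the elements
`α ∈ l·ℤ ⊆ Aut(T_{Ÿ_v})` (through `F̲_v → F÷_v`): "the action of the group of automorphisms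
`l·ℤ`" on `Θ̲_v` (Ex. 3.2 (ii); Rmk 3.2.3 (i) `Θ̲_v ↦ Θ̲^α_v`). [claim: Mochizuki2012, status: disputed] -/
def conjMaps (B : BadLocalFrobenioid.{u} l Kv) :
    Set (Aut (B.birat.obj (B.T B.Ydd)) → Aut (B.birat.obj (B.T B.Ydd))) :=
  {c | ∃ α ∈ B.lZ, ∀ x, c x = (B.birat.mapIso α).symm ≪≫ x ≪≫ B.birat.mapIso α}

/-- Ex. 3.2 (ii): "`Θ̲_v` is completely determined up to multiplication by a `2l`-th root of unity
[i.e., an element of `μ_{2l}(T^÷_{Ÿ_v})`] and the action of the group of automorphisms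
`l·ℤ ⊆ Aut(T_{Ÿ_v})`" — the indeterminacy ORBIT of `Θ̲_v`, DEFINED as the least set containing `Θ̲_v`
stable under both (so it is generated by them, not merely bounded below); its members are the
"`Θ̲^α_v`" of Rmk 3.2.3 (i). [claim: Mochizuki2012, status: disputed] -/
def thetaOrbit (B : BadLocalFrobenioid.{u} l Kv) : Set (Aut (B.birat.obj (B.T B.Ydd))) :=
  orbitClosure B.theta B.unitsTY l B.conjMaps

/-- `Θ̲_v` is in its orbit — PROVED. [claim: Mochizuki2012, status: disputed] -/
theorem theta_mem_thetaOrbit (B : BadLocalFrobenioid.{u} l Kv) : B.theta ∈ B.thetaOrbit :=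
  mem_orbitClosure_self _ _ _ _

/-- The orbit is `μ_{2l}`-stable — PROVED. [claim: Mochizuki2012, status: disputed] -/
theorem mu2l_mul_mem_thetaOrbit (B : BadLocalFrobenioid.{u} l Kv) {ζ x : Aut (B.birat.obj (B.T B.Ydd))}
    (hζ : ζ ∈ B.mu2l) (hx : x ∈ B.thetaOrbit) : ζ * x ∈ B.thetaOrbit :=
  mul_mem_orbitClosure hζ.1 hζ.2 hx

/-- The orbit is stable under the conjugation action of `l·ℤ` — PROVED.
[claim: Mochizuki2012, status: disputed] -/
theorem conj_mem_thetaOrbit (B : BadLocalFrobenioid.{u} l Kv) {α : Aut (B.T B.Ydd)} (hα : α ∈ B.lZ)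
    {x : Aut (B.birat.obj (B.T B.Ydd))} (hx : x ∈ B.thetaOrbit) :
    (B.birat.mapIso α).symm ≪≫ x ≪≫ B.birat.mapIso α ∈ B.thetaOrbit := by
  have h := map_mem_orbitClosure (θ := B.theta) (U := B.unitsTY) (l := l) (C := B.conjMaps)
    (c := fun y => (B.birat.mapIso α).symm ≪≫ y ≪≫ B.birat.mapIso α) ⟨α, hα, fun _ => rfl⟩ hx
  exact h

/-- `τ^Θ_v`, "a `μ_{2l}(−)`-orbit of characteristic splittings … determined by `Θ̲_v`" (Ex. 3.2 (v)):
the splittings determined by the `μ_{2l}`-multiples of `Θ̲_v`. [claim: Mochizuki2012, status: disputed] -/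
def tauThetaOrbit (B : BadLocalFrobenioid.{u} l Kv) : Set (S3Local.CharSplitting B.CTheta) :=
  {τ | ∃ ζ ∈ B.mu2l, τ = B.tauThetaOf (ζ * B.theta)}

/-- `tauTheta ∈ τ^Θ_v` (`ζ = 1`) — PROVED. [claim: Mochizuki2012, status: disputed] -/
theorem tauTheta_mem_tauThetaOrbit (B : BadLocalFrobenioid.{u} l Kv) :
    B.tauTheta ∈ B.tauThetaOrbit :=
  ⟨1, ⟨B.unitsTY.one_mem, one_pow _⟩, by rw [one_mul]; rfl⟩

/-- Ex. 3.2 (ii): "`F÷_v := F̲_v^birat` may be reconstructed category-theoretically from `F̲_v`" ([FrdI]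
Cor. 4.10; [EtTh] Prop. 5.1) — typed as a statement (Rmk 3.2.1 (i) reading).
[claim: Mochizuki2012, status: disputed] -/
def BiratFromF (B : BadLocalFrobenioid.{u} l Kv) : Prop :=
  ∀ e : B.Fv ≌ B.Fv, ∃ e' : B.Fbirat ≌ B.Fbirat, Nonempty (B.birat ⋙ e'.functor ≅ e.functor ⋙ B.birat)

/-- Ex. 3.2 (iii): "the `p_v`-adic Frobenioid … `C_v ⊆ F̲_v` … may be reconstructed
category-theoretically from `F̲_v`" ([EtTh] Cor. 3.8 (ii), Prop. 5.1) — typed as a statement.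
[claim: Mochizuki2012, status: disputed] -/
def CFromF (B : BadLocalFrobenioid.{u} l Kv) : Prop := ReconstructibleAlong B.hull

/-- Ex. 3.2 (ii): "`T_{Ÿ_v}` [regarded up to isomorphism] and `Θ̲_v` [regarded up to the
`μ_{2l}(T^÷_{Ÿ_v})`, `l·ℤ` indeterminacies] may be reconstructed category-theoretically from `F̲_v`"
([EtTh] Thm. 5.7) — typed as a statement: a self-equivalence `e` of `F̲_v` lifts compatibly to
`F÷_v`, carries the Frobenius-trivial object `T_{Ÿ_v}` to an isomorphic object (`j`), and — through
the resulting identification of `T^÷_{Ÿ_v}` — carries the orbit of `Θ̲_v` into itself.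
[claim: Mochizuki2012, status: disputed] -/
def ThetaFromF (B : BadLocalFrobenioid.{u} l Kv) : Prop :=
  ∀ e : B.Fv ≌ B.Fv, ∃ (e' : B.Fbirat ≌ B.Fbirat) (η : B.birat ⋙ e'.functor ≅ e.functor ⋙ B.birat)
    (j : e.functor.obj (B.T B.Ydd) ≅ B.T B.Ydd),
      ∀ x ∈ B.thetaOrbit,
        (η.app (B.T B.Ydd) ≪≫ B.birat.mapIso j).symm ≪≫ e'.functor.mapIso x ≪≫
          (η.app (B.T B.Ydd) ≪≫ B.birat.mapIso j) ∈ B.thetaOrbit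

/-- Ex. 3.2 (vi) (a): "the subcategory `D⊢_v ⊆ D_v` may be reconstructed category-theoretically from
`D_v`" ([AbsAnab] Lemma 1.3.8) — typed as a statement. [claim: Mochizuki2012, status: disputed] -/
def DdashFromD (B : BadLocalFrobenioid.{u} l Kv) : Prop := ReconstructibleAlong B.incl

/-- Ex. 3.2 (vi) (b): "the category `D^Θ_v` may be reconstructed category-theoretically from `D_v`"
— typed as a statement (through the slice over `Ÿ_v`). [claim: Mochizuki2012, status: disputed] -/
def DThetaFromD (B : BadLocalFrobenioid.{u} l Kv) : Prop := ReconstructibleAlong (B.DThetaIncl ⋙ Over.forget B.Ydd)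

/-- Ex. 3.2 (vi) (c): "the category `D⊢_v` (respectively, `D^Θ_v`) may be reconstructed
category-theoretically from `C⊢_v` (respectively, `C^Θ_v`)" ([FrdI] Thm. 3.4 (v); [FrdII] Thm. 1.2
(i); …) — typed as a statement: base functors descend self-equivalences.
[claim: Mochizuki2012, status: disputed] -/
def BasesFromC (B : BadLocalFrobenioid.{u} l Kv) : Prop :=
  (∀ e : B.Cdash ≌ B.Cdash, ∃ e' : B.Ddash ≌ B.Ddash,
      Nonempty (B.CdashBase ⋙ e'.functor ≅ e.functor ⋙ B.CdashBase)) ∧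
    ∀ e : B.CTheta ≌ B.CTheta, ∃ e' : B.DTheta ≌ B.DTheta,
      Nonempty (B.CThetaBase ⋙ e'.functor ≅ e.functor ⋙ B.CThetaBase)

/-- Ex. 3.2 (vi) (d): "the category `D_v` may be reconstructed category-theoretically either from
`F̲_v` ([EtTh] Thm. 4.4, Prop. 5.1) or from `C_v` ([FrdI] Thm. 3.4 (v); …)" — typed as a statement.
[claim: Mochizuki2012, status: disputed] -/
def DFromF (B : BadLocalFrobenioid.{u} l Kv) : Prop :=
  (∀ e : B.Fv ≌ B.Fv, ∃ e' : B.Dv ≌ B.Dv, Nonempty (B.toBase ⋙ e'.functor ≅ e.functor ⋙ B.toBase)) ∧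
    ∀ e : B.Cv ≌ B.Cv, ∃ e' : B.Dv ≌ B.Dv,
      Nonempty ((B.hull ⋙ B.toBase) ⋙ e'.functor ≅ e.functor ⋙ (B.hull ⋙ B.toBase))

/-- Ex. 3.2 (vi) (e): "one may reconstruct the split Frobenioid `F^Θ_v` [up to the `l·ℤ`
indeterminacy in `Θ̲_v` discussed in (ii); cf. also Remark 3.2.3 below] category-theoretically from
`F̲_v`" ([FrdI] Thm. 3.4 (i), (v); [EtTh] Prop. 5.1) — typed as a statement: a self-equivalence of
`F̲_v` induces compatible self-equivalences of `F÷_v` and of `C^Θ_v ⊆ F÷_v` carrying the splitting of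
`Θ̲_v` to the splitting of SOME member of the indeterminacy orbit of `Θ̲_v` (`μ_{2l}` and `l·ℤ`).
[claim: Mochizuki2012, status: disputed] -/
def FthetaFromF (B : BadLocalFrobenioid.{u} l Kv) : Prop :=
  ∀ e : B.Fv ≌ B.Fv, ∃ e' : B.Fbirat ≌ B.Fbirat, ∃ e'' : B.CTheta ≌ B.CTheta,
    Nonempty (B.birat ⋙ e'.functor ≅ e.functor ⋙ B.birat) ∧
      Nonempty (B.CThetaToBirat ⋙ e'.functor ≅ e''.functor ⋙ B.CThetaToBirat) ∧
        ∃ x ∈ B.thetaOrbit, B.tauTheta.IsPreservedBy (B.tauThetaOf x) e''.functor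

/-- Ex. 3.2 (vi) (f): "one may reconstruct the split Frobenioid `F⊢_v` category-theoretically from
`C_v`, hence also [cf. (iii)] from `F̲_v`" (via the étale theta function [EtTh] Cor. 2.8 (i) and the
cyclotomic rigidity of [AbsTopIII] Cor. 1.10 (c)) — typed as a statement (the `C_v` half; "hence
also from `F̲_v`" is its conjunction with `CFromF`): the induced self-equivalence of `C⊢_v` carries the
recorded member of the orbit `τ⊢_v` to SOME member of `τ⊢_v` (the orbit, not the member, is
preserved). [claim: Mochizuki2012, status: disputed] -/
def FdashFromC (B : BadLocalFrobenioid.{u} l Kv) : Prop :=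
  ∀ e : B.Cv ≌ B.Cv, ∃ e' : B.Cdash ≌ B.Cdash,
    Nonempty (B.CdashToC ⋙ e.functor ≅ e'.functor ⋙ B.CdashToC) ∧
      ∃ τ' ∈ B.tauDashOrbit, B.tauDash.IsPreservedBy τ' e'.functor

/-- Remark 3.2.3 (i), p. 74: for `α ∈ Aut_{D_v}(Ÿ_v)`, "`α_{𝒪^▷}` [is] an isomorphism of the monoid
`𝒪^▷_{C^Θ_v}(−)` on `D^Θ_v` associated to `Θ̲_v` onto the corresponding monoid on `D^Θ_v` associated
to the `α`-conjugate `Θ̲^α_v` … [hence] `α` induces an isomorphism of the split Frobenioid `F^Θ_v` …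
onto the split Frobenioid `F^{Θ^α}_v` … which lies over the identity functor on `D^Θ_v`" — typed as a
statement FOR EACH member `Θ̲′` of the orbit: the monoid of `Θ̲_v` and that of `Θ̲′` are isomorphic as
monoids on `D^Θ_v` (the Frobenioid-level isomorphism over `𝟭_{D^Θ_v}` is its printed consequence,
[FrdII] Ex. 1.1 (ii)). [claim: Mochizuki2012, status: disputed] -/
def OrbitActsOnFtheta (B : BadLocalFrobenioid.{u} l Kv) : Prop :=
  ∀ x ∈ B.thetaOrbit, Nonempty (B.OTheta ≅ B.OThetaOf x)

end BadLocalFrobenioid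

end Literature.IUT.HodgeTheaters
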